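import Literature.AlgebraicGeometry.HodgeTheory.BettiKunnethPiecesJointActionCriteria
import Literature.AlgebraicGeometry.HodgeTheory.BettiKunnethPiecesHardLefschetzReduction
import HarnessLib

/-!
# `HC(S × X)` for EVERY smooth projective surface `S` and every `n`-fold `X` with `HC(X)`: iff for each `c` with `2 ≤ c`, `2c ≤ n + 2` every pair of morphisms of `ℚ`-Hodge structures
# `φ₂ : H^{2n+2−2c}(X) → H²(S)(c − n)` and (when `2c ≤ n + 1`) `φ₁ : H^{2n+1−2c}(X) → H¹(S)(c − n)` is JOINTLY induced by one rational algebraic class of `H^{2c}(S × X)`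
# (Voisin I §11.3.3 Thm. 11.38–11.40, Lemma 11.41, pp. 285–287; §6.2.3 Thm. 6.25, Rem. 6.27; §7.3.1 Def. 7.22, §7.3.2; Thm. 11.30; Voisin II Prop. 9.20; Voisin 2025 §3.2.1)

Family `hodge`, lane `lit-hodgefound` (Track 2 foundations library; Layers A1/A4), layer `Literature/AlgebraicGeometry/HodgeTheory`.  THEOREMS ONLY (no definition, no named fact, no instance;
D-0026 net debt `0`).  The seat's g31-#6 gave the joint-action criterion relative to a set of Künneth pieces with free complement, g31-#7 read it on `S × T`.  Here the first factor is a surface and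
the second an ARBITRARY `n`-fold `X` with `HC(X)`, in EVERY degree `2c`, by strong induction on `c`: the pieces of `H^{2c}(S × X)` are `Hⁱ(S) ⊗ H^{2c−i}(X)`, `0 ≤ i ≤ 4`; `i = 0` is free (`HC(X)`),
`i = 4` reduces by hard Lefschetz on `S` (`L² : H⁰ ⥲ H⁴`) to `i = 0` in degree `2c − 4`, `i = 3` reduces (`L : H¹ ⥲ H³`) to the piece `H¹(S) ⊗ H^{2c−3}(X)` of degree `2c − 2` — settled at the previous
step of the induction — and the pieces `i = 1, 2` with `2c − i > n` reduce by hard Lefschetz on `X` to degrees `< 2c`.  What is left at level `c` (for `2 ≤ c`, `2c ≤ n + 2`) is the pair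
`H²(S) ⊗ H^{2c−2}(X)`, `H¹(S) ⊗ H^{2c−1}(X)` (the latter only when `2c − 1 ≤ n`), whose Hodge classes are, by Lemma 11.41 with integer twists (g31-#2), the morphisms of Hodge structures
`φ₂ : H^{2n+2−2c}(X) → H²(S)(c − n)`, `φ₁ : H^{2n+1−2c}(X) → H¹(S)(c − n)`.  Hence the title statement — with NO hypothesis on `S` and only `HC(X)` on `X` (e.g. `X` a curve, surface, threefold, an
odd-dimensional hypersurface, a variety with algebraic cohomology).  For `X = T` a threefold it is g31-#7's criterion (`c = 2`); for `X = S'` a surface the pair at `c = 2` is (`φ₂ : H²S' → H²S`,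
no `φ₁`), i.e. the seat's g30-#18.

WHAT IS PROVED (complex orientations).
* §1 **`BettiUniverse.surface_tensor_forall_hodgeClasses_algebraic_of_joint_corrAction`** — `HC(X)` and, for `2 ≤ c`, `2c ≤ n + 2`, the joint criterion on the Hodge families of the pieces
  `j = 2c − 2` and (`2c ≤ n + 1`) `j = 2c − 1` ⇒ every Hodge class of every `H^{2c}(S × X)` is algebraic (strong induction on `c`; g31-#6 with the free complement supplied by the tree's reductions).
* §2 **`BettiUniverse.hodgeConjectureFor_surface_tensor_iff_forall_hom_pair_exists_algebraic`** — the title statement: under `HC(X)`, `HC(S × X)` iff for all `c` (`2 ≤ c`, `2c ≤ n + 2`, `n + r = c`),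
  all `φ₂ ∈ Hom_HS(H^{2n+2−2c}X, H²S(r))` and all `φ₁ : 2c ≤ n + 1 → Hom_HS(H^{2n+1−2c}X, H¹S(r))` there is `γ ∈ H^{2c}(S × X;ℚ)` with `γ ⊗ 1` algebraic, `(γ ⊗ 1)_*(v ⊗ 1) = φ₂(v) ⊗ 1` on
  `H^{2n+2−2c}(X)` and `= φ₁(v) ⊗ 1` on `H^{2n+1−2c}(X)`.

THE PRINTS.  C. Voisin (2002) [VoisinHodgeI2002] §6.2.3 Thm. 6.25, Rem. 6.27 (hard Lefschetz, `L` of bidegree `(1,1)`); §7.3.1 Def. 7.22, Lemma 7.23; §7.3.2; §11.3.1 Thm. 11.30 (Lefschetz `(1,1)`); §11.3.3 Thm.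
11.38–11.40, Lemma 11.41 and pp. 285–287.  C. Voisin (2003) [VoisinHodgeII2003] §9.2.4 Prop. 9.20 (for divisors, a tree theorem).  C. Voisin (2025) [Voisin2025] §3.2.1 (12)–(14), Prop. 3.8, Cor. 3.9.
P. Deligne (2000/2006) [Deligne2000] §1.

THE OBJECTS (all the tree's).  `BettiUniverse.KunnethSrc`, `BettiUniverse.kunnethSummand`, `BettiUniverse.crossMap`, `BettiUniverse.hodge`, `corrAction complexOrientationFamily`, `HodgeStructure.Hom`, `tateTwist` (`r : ℤ`),
`cast`, `hodgeClasses`, `ofRatClass`, `algebraicClasses`, `HodgeConjectureFor`; the seat's g31-#6 `BettiUniverse.forall_hodgeClasses_algebraic_of_joint_corrAction`, g31-#2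
`…exists_hom_tateTwist_int_of_mem_hodgeClasses_kunnethSummand`, `…exists_mem_hodgeClasses_corrAction_crossMap_eq_ofRatClass_hom_int`, g30-#13 `BettiUniverse.span_range_ofRatClass_eq_top`, the tree's
`…ofRatClass_crossMap_mem_algebraicClasses_of_lefschetzRange/_of_lt/_of_fst_zero/_of_hardLefschetz_left/_of_hardLefschetz_right`, `BettiUniverse.crossMap_mem_hodgeClasses`,
`corrAction_eq_zero_of_mem_kunnethPiece_of_ne`, `ofRatClass_crossMap_mem_kunnethPiece`, `hodgeConjectureFor_iff_of_hodgeModel`, `BettiUniverse.forall_mem_hodgeClasses_hodge_iff`.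

DEVIATIONS / SCOPE.  Complex orientations; `HC(X)` is a hypothesis (it is a consequence of `HC(S × X)`, not re-derived here).  No definitions.

## References
* [VoisinHodgeI2002] C. Voisin, *Hodge Theory and Complex Algebraic Geometry I* (2002) — §6.2.3 Thm. 6.25, Rem. 6.27; §7.3.1 Def. 7.22, Lemma 7.23; §7.3.2; §11.3.1 Thm. 11.30; §11.3.3 Thm. 11.38–11.40, Lemma 11.41, pp. 285–287.
* [VoisinHodgeII2003] C. Voisin, *Hodge Theory and Complex Algebraic Geometry II* (2003) — §9.2.4 Prop. 9.20.
* [Voisin2025] C. Voisin, *Cycle classes on algebraic varieties* (2025) — §3.2.1 (12)–(14), Prop. 3.8, Cor. 3.9.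
* [Deligne2000] P. Deligne, *The Hodge conjecture* (Clay problem description) — §1.

## Provenance
Lane `lit-hodgefound` (Hodge path, Track 2), prover seat `lit-hodgefound-p29` (generation 31), self-proposed row g31-#8 (surface × arbitrary variety: the joint `Hom_HS` pair criterion in every degree,
g31-#6 + the tree's hard-Lefschetz reductions).
-/

noncomputable section

open scoped TensorProduct
open CategoryTheory MonoidalCategory CartesianMonoidalCategory Module Finset
open Literature.AlgebraicTopology.SingularHomology
open Literature.Geometry.Kaehler

namespace Literature.AlgebraicGeometry.HodgeTheory

open Literature.AlgebraicGeometry.Motives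
open Literature.AlgebraicGeometry.Motives.HodgeStructure

variable {n d : ℕ} {S X : SchemeOver ℂ}

variable [HodgeTensorFacts.{0, 0}]

/-! ### §1 All degrees, by strong induction on `c` -/

/-- **Surface × `n`-fold, all degrees.**  Let `S` be a smooth projective surface, `X` a smooth projective `n`-fold with `HC(X)`, and suppose that for every `c` with `2 ≤ c`, `2c ≤ n + 2` and every family
`(t_{ij})` of Hodge classes of the Künneth summands of `H^{2c}(S × X)` there is a rational class `γ` with `γ ⊗ 1` algebraic acting on `H^{2n−j}(X;ℂ)` as `crossMap t_{ij} ⊗ 1` for `j = 2c − 2` and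
(when `2c ≤ n + 1`) for `j = 2c − 1`.  Then EVERY Hodge class of EVERY `H^{2c}(S × X)` is algebraic.  Strong induction on `c`: the complement of these pieces is free — `i = 0` by `HC(X)`, `i = 4` and
`i = 3` by hard Lefschetz on `S` (reduced to `i = 0` in degree `2c − 4`, resp. to the piece `H¹(S) ⊗ H^{2c−3}(X)` of degree `2c − 2`, algebraic by induction), `i = 1, 2` with `2c − i > n` by hard
Lefschetz on `X` (reduced to degrees `< 2c`), `i > 4` or `2c − i > 2n` zero, `c ≤ 1` the Lefschetz range — and g31-#6 applies.
[cite: VoisinHodgeI2002, §6.2.3 Thm. 6.25, Rem. 6.27, §11.3.1 Thm. 11.30, §11.3.3 Thm. 11.38–11.40, Lemma 11.41 and pp. 285–287] [cite: VoisinHodgeII2003, §9.2.4 Prop. 9.20] [cite: Voisin2025, §3.2.1 (12)–(14), Prop. 3.8 and Cor. 3.9] -/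
theorem BettiUniverse.surface_tensor_forall_hodgeClasses_algebraic_of_joint_corrAction (hHD : exists_isReal_hodgeModel) (hS : IsSmoothProjective 2 S) (hX : IsSmoothProjective n X)
    (hSX : IsSmoothProjective d (S ⊗ X)) (hHCX : HodgeConjectureFor n X)
    (hJ : ∀ c : ℕ, 2 ≤ c → 2 * c ≤ n + 2 → ∀ t : BettiUniverse.KunnethSrc S X (2 * c), (∀ ij, t ij ∈ (BettiUniverse.kunnethSummand hHD hS hX (2 * c) ij).hodgeClasses c) →
      ∃ γ : bettiCohomology (S ⊗ X) (2 * c), ofRatClass (ComplexPoints (S ⊗ X)) (2 * c) γ ∈ algebraicClasses (S ⊗ X) c ∧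
        ∀ (i j a : ℕ) (hij : i + j = 2 * c) (_haj : a + j = 2 * n) (hab : a + 2 * c = i + 2 * n), (j = 2 * c - 1 ∧ 2 * c ≤ n + 1) ∨ j = 2 * c - 2 →
          corrAction complexOrientationFamily hS hX hab (ofRatClass (ComplexPoints (S ⊗ X)) (2 * c) γ) =
            corrAction complexOrientationFamily hS hX hab (ofRatClass (ComplexPoints (S ⊗ X)) (2 * c) (BettiUniverse.crossMap S X hij (t ⟨(i, j), HasAntidiagonal.mem_antidiagonal.2 hij⟩))))
    (c : ℕ) : ∀ v ∈ (BettiUniverse.hodge hHD hSX (2 * c)).hodgeClasses c, ofRatClass (ComplexPoints (S ⊗ X)) (2 * c) v ∈ algebraicClasses (S ⊗ X) c := by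
  have hI := hodgePQ_independent_of_hodgeModel_holds
  have hHCXc : ∀ c' : ℕ, ∀ x ∈ (BettiUniverse.hodge hHD hX (2 * c')).hodgeClasses c', ofRatClass (ComplexPoints X) (2 * c') x ∈ algebraicClasses X c' :=
    fun c' x hx ↦ hHCX.2 c' _ (isRationalClass_ofRatClass _) ((BettiUniverse.mem_hodgeClasses_hodge_iff_isOfHodgeType hHD hX c' x).1 hx)
  induction c using Nat.strong_induction_on with
  | _ c IH =>
  refine BettiUniverse.forall_hodgeClasses_algebraic_of_joint_corrAction complexOrientationFamily hHD hS hX hSX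
    (fun j ↦ 2 ≤ c ∧ 2 * c ≤ n + 2 ∧ ((j = 2 * c - 1 ∧ 2 * c ≤ n + 1) ∨ j = 2 * c - 2)) (fun i j hij hP u hu ↦ ?_) (fun t ht ↦ ?_)
  · -- the free complement
    by_cases hc1 : c ≤ 1
    · exact BettiUniverse.ofRatClass_crossMap_mem_algebraicClasses_of_lefschetzRange hHD hS hX hSX hij (Or.inl hc1) hu
    by_cases hi4 : 4 < i
    · exact BettiUniverse.ofRatClass_crossMap_mem_algebraicClasses_of_lt hS hX hij (Or.inl (by omega)) u
    by_cases hj2 : 2 * n < j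
    · exact BettiUniverse.ofRatClass_crossMap_mem_algebraicClasses_of_lt hS hX hij (Or.inr hj2) u
    have hi : i ≤ 4 := not_lt.1 hi4
    interval_cases i
    · -- `i = 0`: `HC(X)` in degree `2c`
      exact BettiUniverse.ofRatClass_crossMap_mem_algebraicClasses_of_fst_zero hHD hS hX hij (hHCXc c) hu
    · -- `i = 1`, `j = 2c − 1 > n`: hard Lefschetz on `X` down to degree `2(n + 1 − c) < 2c`
      have hjn : n < j := by
        by_contra hle
        exact hP ⟨by omega, by omega, Or.inl ⟨by omega, by omega⟩⟩
      exact BettiUniverse.ofRatClass_crossMap_mem_algebraicClasses_of_hardLefschetz_right hHD hS hX hSX (j₀ := 2 * n - j) (s := j - n) (c₀ := n + 1 - c) (by omega) (by omega) (by omega) hij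
        (fun w hw ↦ IH (n + 1 - c) (by omega) _ (BettiUniverse.crossMap_mem_hodgeClasses hHD hI hS hX hSX _ _ hw)) hu
    · -- `i = 2`, `j = 2c − 2 > n`: hard Lefschetz on `X` down to degree `2(n + 2 − c) < 2c`
      have hjn : n < j := by
        by_contra hle
        exact hP ⟨by omega, by omega, Or.inr (by omega)⟩
      exact BettiUniverse.ofRatClass_crossMap_mem_algebraicClasses_of_hardLefschetz_right hHD hS hX hSX (j₀ := 2 * n - j) (s := j - n) (c₀ := n + 2 - c) (by omega) (by omega) (by omega) hij
        (fun w hw ↦ IH (n + 2 - c) (by omega) _ (BettiUniverse.crossMap_mem_hodgeClasses hHD hI hS hX hSX _ _ hw)) hu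
    · -- `i = 3`: hard Lefschetz on `S` down to the piece `H¹(S) ⊗ H^{2c−3}(X)` of degree `2c − 2`
      exact BettiUniverse.ofRatClass_crossMap_mem_algebraicClasses_of_hardLefschetz_left hHD hS hX hSX (i₀ := 1) (s := 1) (c₀ := c - 1) (by omega) (by omega) (by omega) hij
        (fun w hw ↦ IH (c - 1) (by omega) _ (BettiUniverse.crossMap_mem_hodgeClasses hHD hI hS hX hSX _ _ hw)) hu
    · -- `i = 4`: hard Lefschetz on `S` down to `H⁰(S) ⊗ H^{2c−4}(X)`, free by `HC(X)`
      exact BettiUniverse.ofRatClass_crossMap_mem_algebraicClasses_of_hardLefschetz_left hHD hS hX hSX (i₀ := 0) (s := 2) (c₀ := c - 2) (by omega) (by omega) (by omega) hij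
        (fun w hw ↦ BettiUniverse.ofRatClass_crossMap_mem_algebraicClasses_of_fst_zero hHD hS hX _ (hHCXc (c - 2)) hw) hu
  · -- the joint criterion on the two pieces
    by_cases hc : 2 ≤ c ∧ 2 * c ≤ n + 2
    · obtain ⟨γ, hγ, hact⟩ := hJ c hc.1 hc.2 t ht
      exact ⟨γ, hγ, fun i j a hij haj hab hP ↦ hact i j a hij haj hab hP.2.2⟩
    · refine ⟨0, by rw [map_zero]; exact Submodule.zero_mem _, fun i j a hij haj hab hP ↦ absurd ⟨hP.1, hP.2.1⟩ hc⟩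

/-! ### §2 The `Hom_HS` pair criterion -/

/-- **`HC(S × X)` for EVERY smooth projective surface `S` and every smooth projective `n`-fold `X` with `HC(X)` IFF for every `c` with `2 ≤ c`, `2c ≤ n + 2` (`n + r = c`), every morphism of `ℚ`-Hodge
structures `φ₂ : H^{2n+2−2c}(X) → H²(S)(r)` and — when `2c ≤ n + 1` — every `φ₁ : H^{2n+1−2c}(X) → H¹(S)(r)` are JOINTLY induced by a rational class `γ ∈ H^{2c}(S × X;ℚ)` with `γ ⊗ 1` algebraic:
`(γ ⊗ 1)_*(v ⊗ 1) = φ₂(v) ⊗ 1` for `v ∈ H^{2n+2−2c}(X;ℚ)` and `(γ ⊗ 1)_*(w ⊗ 1) = φ₁(w) ⊗ 1` for `w ∈ H^{2n+1−2c}(X;ℚ)`** (complex orientations).  «⇒»: the Hodge classes `t₂`, `t₁` with `φ_{t} = φ`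
(g31-#2) give `γ = crossMap t₂ + crossMap t₁`, algebraic by `HC(S × X)`, each summand acting only on its own degree.  «⇐»: §1. [cite: VoisinHodgeI2002, §7.3.1 Def. 7.22, §7.3.2, §11.3.3 Thm. 11.38–11.40, Lemma 11.41 and pp. 285–287, §6.2.3 Thm. 6.25, §11.3.1 Thm. 11.30]
[cite: Voisin2025, §3.2.1 (12)–(14), Prop. 3.8 and Cor. 3.9] [cite: Deligne2000, §1] -/
theorem BettiUniverse.hodgeConjectureFor_surface_tensor_iff_forall_hom_pair_exists_algebraic (hHD : exists_isReal_hodgeModel) (hS : IsSmoothProjective 2 S) (hX : IsSmoothProjective n X)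
    (hSX : IsSmoothProjective d (S ⊗ X)) (hHCX : HodgeConjectureFor n X) :
    HodgeConjectureFor d (S ⊗ X) ↔
      ∀ (c : ℕ) (r : ℤ) (_hc2 : 2 ≤ c) (hcn : 2 * c ≤ n + 2) (_hr : ((n : ℕ) : ℤ) + r = ((c : ℕ) : ℤ))
        (φ₂ : HodgeStructure.Hom (BettiUniverse.hodge hHD hX (2 * n + 2 - 2 * c)) (((BettiUniverse.hodge hHD hS 2).tateTwist r).cast (by omega)))
        (φ₁ : 2 * c ≤ n + 1 → HodgeStructure.Hom (BettiUniverse.hodge hHD hX (2 * n + 1 - 2 * c)) (((BettiUniverse.hodge hHD hS 1).tateTwist r).cast (by omega))),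
        ∃ γ : bettiCohomology (S ⊗ X) (2 * c), ofRatClass (ComplexPoints (S ⊗ X)) (2 * c) γ ∈ algebraicClasses (S ⊗ X) c ∧
          (∀ v, corrAction complexOrientationFamily hS hX (show (2 * n + 2 - 2 * c) + 2 * c = 2 + 2 * n by omega) (ofRatClass (ComplexPoints (S ⊗ X)) (2 * c) γ)
              (ofRatClass (ComplexPoints X) (2 * n + 2 - 2 * c) v) = ofRatClass (ComplexPoints S) 2 (φ₂.toLinearMap v)) ∧
          (∀ (h : 2 * c ≤ n + 1) (w : bettiCohomology X (2 * n + 1 - 2 * c)),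
            corrAction complexOrientationFamily hS hX (show (2 * n + 1 - 2 * c) + 2 * c = 1 + 2 * n by omega) (ofRatClass (ComplexPoints (S ⊗ X)) (2 * c) γ)
              (ofRatClass (ComplexPoints X) (2 * n + 1 - 2 * c) w) = ofRatClass (ComplexPoints S) 1 ((φ₁ h).toLinearMap w)) := by
  constructor
  · intro hHC c r hc2 hcn hr φ₂ φ₁
    have hall : ∀ v ∈ (BettiUniverse.hodge hHD hSX (2 * c)).hodgeClasses c, ofRatClass (ComplexPoints (S ⊗ X)) (2 * c) v ∈ algebraicClasses (S ⊗ X) c :=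
      fun v hv ↦ hHC.2 c _ (isRationalClass_ofRatClass _) ((BettiUniverse.mem_hodgeClasses_hodge_iff_isOfHodgeType hHD hSX c v).1 hv)
    have h2e : 2 + (2 * c - 2) = 2 * c := by omega
    obtain ⟨t₂, ht₂, h₂⟩ := BettiUniverse.exists_mem_hodgeClasses_corrAction_crossMap_eq_ofRatClass_hom_int hHD hS hX h2e (show (2 * n + 2 - 2 * c) + (2 * c - 2) = 2 * n by omega)
      (show (2 * n + 2 - 2 * c) + 2 * c = 2 + 2 * n by omega) hr (by omega) φ₂
    by_cases h1 : 2 * c ≤ n + 1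
    · have h1e : 1 + (2 * c - 1) = 2 * c := by omega
      obtain ⟨t₁, ht₁, h₁⟩ := BettiUniverse.exists_mem_hodgeClasses_corrAction_crossMap_eq_ofRatClass_hom_int hHD hS hX h1e (show (2 * n + 1 - 2 * c) + (2 * c - 1) = 2 * n by omega)
        (show (2 * n + 1 - 2 * c) + 2 * c = 1 + 2 * n by omega) hr (by omega) (φ₁ h1)
      refine ⟨BettiUniverse.crossMap S X h2e t₂ + BettiUniverse.crossMap S X h1e t₁, ?_, fun v ↦ ?_, fun h w ↦ ?_⟩
      · rw [map_add]
        exact Submodule.add_mem _ (hall _ (BettiUniverse.crossMap_mem_hodgeClasses hHD hodgePQ_independent_of_hodgeModel_holds hS hX hSX h2e c ht₂))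
          (hall _ (BettiUniverse.crossMap_mem_hodgeClasses hHD hodgePQ_independent_of_hodgeModel_holds hS hX hSX h1e c ht₁))
      · rw [map_add, map_add, LinearMap.add_apply, h₂ v,
          corrAction_eq_zero_of_mem_kunnethPiece_of_ne complexOrientationFamily hS hX (e := c) (i := 2 * c - 1) (j := 1) h1e (ofRatClass_crossMap_mem_kunnethPiece h1e t₁)
            (show (2 * n + 2 - 2 * c) + 2 * c = 2 + 2 * n by omega) (show (2 * n + 2 - 2 * c) + (2 * c - 1) ≠ 2 * n by omega), LinearMap.zero_apply, add_zero]
      · rw [map_add, map_add, LinearMap.add_apply, h₁ w,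
          corrAction_eq_zero_of_mem_kunnethPiece_of_ne complexOrientationFamily hS hX (e := c) (i := 2 * c - 2) (j := 2) h2e (ofRatClass_crossMap_mem_kunnethPiece h2e t₂)
            (show (2 * n + 1 - 2 * c) + 2 * c = 1 + 2 * n by omega) (show (2 * n + 1 - 2 * c) + (2 * c - 2) ≠ 2 * n by omega), LinearMap.zero_apply, zero_add]
    · refine ⟨BettiUniverse.crossMap S X h2e t₂, hall _ (BettiUniverse.crossMap_mem_hodgeClasses hHD hodgePQ_independent_of_hodgeModel_holds hS hX hSX h2e c ht₂), fun v ↦ h₂ v,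
        fun h _ ↦ absurd h h1⟩
  · intro h
    -- §1 in every degree
    have hall : ∀ c, ∀ v ∈ (BettiUniverse.hodge hHD hSX (2 * c)).hodgeClasses c, ofRatClass (ComplexPoints (S ⊗ X)) (2 * c) v ∈ algebraicClasses (S ⊗ X) c := by
      refine BettiUniverse.surface_tensor_forall_hodgeClasses_algebraic_of_joint_corrAction hHD hS hX hSX hHCX fun c hc2 hcn t ht ↦ ?_
      have h2e : 2 + (2 * c - 2) = 2 * c := by omega
      have h1e : 1 + (2 * c - 1) = 2 * c := by omega
      obtain ⟨φ₂, hφ₂⟩ := BettiUniverse.exists_hom_tateTwist_int_of_mem_hodgeClasses_kunnethSummand hHD hS hX h2e (show (2 * n + 2 - 2 * c) + 2 * c = 2 + 2 * n by omega)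
        (show ((n : ℕ) : ℤ) + (((c : ℕ) : ℤ) - ((n : ℕ) : ℤ)) = ((c : ℕ) : ℤ) by omega) (by omega) (ht ⟨(2, 2 * c - 2), HasAntidiagonal.mem_antidiagonal.2 h2e⟩)
      obtain ⟨ψ₁, hψ₁⟩ := BettiUniverse.exists_hom_tateTwist_int_of_mem_hodgeClasses_kunnethSummand hHD hS hX h1e (show (2 * n + 1 - 2 * c) + 2 * c = 1 + 2 * n by omega)
        (show ((n : ℕ) : ℤ) + (((c : ℕ) : ℤ) - ((n : ℕ) : ℤ)) = ((c : ℕ) : ℤ) by omega) (by omega) (ht ⟨(1, 2 * c - 1), HasAntidiagonal.mem_antidiagonal.2 h1e⟩)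
      obtain ⟨γ, hγ, hγ₂, hγ₁⟩ := h c (((c : ℕ) : ℤ) - ((n : ℕ) : ℤ)) hc2 hcn (by omega) φ₂ (fun _ ↦ ψ₁)
      refine ⟨γ, hγ, fun i j a hij haj hab hP ↦ ?_⟩
      rcases hP with ⟨rfl, hle⟩ | rfl
      · obtain rfl : i = 1 := by omega
        obtain rfl : a = 2 * n + 1 - 2 * c := by omega
        exact LinearMap.ext_on_range (BettiUniverse.span_range_ofRatClass_eq_top hX (2 * n + 1 - 2 * c)) fun w ↦ by rw [hγ₁ hle w, hψ₁ w]
      · obtain rfl : i = 2 := by omega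
        obtain rfl : a = 2 * n + 2 - 2 * c := by omega
        exact LinearMap.ext_on_range (BettiUniverse.span_range_ofRatClass_eq_top hX (2 * n + 2 - 2 * c)) fun v ↦ by rw [hγ₂ v, hφ₂ v]
    rw [hodgeConjectureFor_iff_of_hodgeModel (BettiUniverse.realHodgeModel hHD hSX)]
    intro c
    rw [← BettiUniverse.forall_mem_hodgeClasses_hodge_iff hHD hSX c]
    exact hall c

end Literature.AlgebraicGeometry.HodgeTheory

end
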